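import Summits.ResolutionOfSingularities.ResolutionOfSingularities.Theorems.MarkedTransferCampaignW24ReducedBridgeMixed
import Summits.ResolutionOfSingularities.ResolutionOfSingularities.Theorems.Rescue.RD2PrimeClearedStep
import HarnessLib

/-!
# The MIXED bridge, part 2: run level, box-confinement, and THE FULL `n = 1, e = 1` SLICE of ⟨`Rescue.FiniteSupportStaysInBox_ours`⟩
# at `p = 2` — `Rescue.CarrierStaysInBox 2 1 ↑P` for EVERY `P ∈ K[x]` (one variable) (HIRONAKA-L · cell `res-hironaka` · slot W2.4;
# companion of `MarkedTransferCampaignW24ReducedBridgeMixed.lean`)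

**HONEST FRAMING.** OURS throughout: kernel theorems connecting OURS objects of the cell — res-L1-k24's reduced runs and res-L1-type-o6's
death theorem (`CampaignW24.ReducedRun`, p509286 / p527449 / p528277), res-D-pv-031's persistence of lower class
(`Rescue.RD2Prime.isLowerClass_stepAt_of_isLowerClass`), res-D-pv-020's bridges (`CampaignW24.ReducedBridge`), res-type-059's run objects
(`CampaignW24.StaysInBox`) and res-rescue-typ-2's `Rescue.CarrierStaysInBox` / `Rescue.FiniteSupportStaysInBox_ours` (p519743). Nothing below
is a statement of H. Hironaka's manuscript [Hironaka2017] (lit key `paper:url-3343fd9e678b`), nothing asserts that any statement of it holds,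
nothing is a claim about resolution of singularities in characteristic `p`, nothing is a verdict word; the manuscript stays «under review»
(D-0012/D-0089). AI work, weaker than expert review. Written by res-D-pv-020 (W2.4 lineage; own object 2026-08-27T12:06Z).

## What is proved (`K` a field of characteristic `2`)
* `isLowerClass_psi` (a purely even series is of lower class below a datum of `mix E₀ G₀`, `E₀ ≠ 0 ≠ G₀`), `alpha_eq_zero_of_psi`.
* run level: `run_eq_mix_canonRun(_digitOne)` (every legal run is `mix E_i (twin state)` up to the reduced death index),
  `isLowerClass_run_of_isLowerClass` (031's persistence iterated), `staysInBox_mix_of_reduced_exhaustion(_digitOne)`.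
* `carrierStaysInBox_mix (E₀ G₀) : Rescue.CarrierStaysInBox 2 1 (mix E₀ G₀)` for EVERY `E₀` and every finitely supported `G₀` (cases `E₀ = 0`:
  twin, o6 p528277 / my p529805; `G₀ = 0` or `G₀(0) ≠ 0`: vacuous; digit `1` / `≥ 2`: the mixed run + o6's `reduced_exhaustion_of_two_le_order`).
* **`carrierStaysInBox_coe_fin_one (P : MvPolynomial (Fin 1) K) : Rescue.CarrierStaysInBox 2 1 ↑P`** — ⟨`Rescue.FiniteSupportStaysInBox_ours 2`⟩
  HOLDS ON THE SLICE `n = 1, e = 1`, no carrier-shape proviso. Nothing claimed for `n ≥ 2`, `e ≥ 2`, odd `p`, infinite support.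
Hypotheses: each theorem's own binders; no FACT-LIST fact, no DEFECT binder; def-free. Host: route MarkedTransfer, item
`HypersurfaceOrderReduction` (stmt-ResolutionOfSingularities-16155), `--as helper`. Standard axioms only.
-/


noncomputable section

set_option linter.dupNamespace false -- mandated namespace of this single-conjunct summit

namespace Summit.ResolutionOfSingularities.ResolutionOfSingularities.Theorems

namespace CampaignW24

namespace ReducedBridge

open Literature.AlgebraicGeometry.Hironaka2017.S08UnitMonomial (StandardExpression)
open Literature.AlgebraicGeometry.Hironaka2017.S09LLUED
open Literature.AlgebraicGeometry.Hironaka2017.S09LLUED.TopFrontier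
open Literature.AlgebraicGeometry.Hironaka2017.S09LLUED.TopDeriv
open Literature.AlgebraicGeometry.Hironaka2017.S09LLUED.FrontierDrop (expo)
open Literature.AlgebraicGeometry.Resolution (adicOrder)
open Literature.RingTheory.MvPowerSeries (adicOrder_eq_order)
open CampaignW21 (xs hasseD)
open Rescue.RD2Prime (isLowerClass_stepAt_of_isLowerClass)

variable {K : Type} [Field K] [CharP K 2]

/-! ## §0 Bookkeeping moved here from part 1 (file-size lint) -/

section Bookkeeping

omit [CharP K 2]

/-- A mixed carrier with no even part is the twin carrier. [folklore] -/
theorem mix_zero_left (G : PowerSeries K) : mix 0 G = phi G := by rw [mix, map_zero, zero_add]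

/-- A mixed carrier with no odd part is purely even. [folklore] -/
theorem mix_zero_right (E : PowerSeries K) : mix E 0 = psi E := by rw [mix, phi, map_zero, mul_zero, add_zero]

/-- Finite support passes to the even part. [folklore] -/
theorem coeff_evenRead_eq_zero_of_bound {F : MvPowerSeries (Fin 1) K} {B : ℕ} (hF : ∀ d : Fin 1 →₀ ℕ, B < d 0 → MvPowerSeries.coeff d F = 0) :
    ∀ m, B < m → PowerSeries.coeff m (evenRead F) = 0 := fun m hm => by
  rw [evenRead, PowerSeries.coeff_mk]
  exact hF _ (by rw [Finsupp.single_eq_same]; omega)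

/-- Finite support passes to the odd part. [folklore] -/
theorem coeff_oddRead_eq_zero_of_bound {F : MvPowerSeries (Fin 1) K} {B : ℕ} (hF : ∀ d : Fin 1 →₀ ℕ, B < d 0 → MvPowerSeries.coeff d F = 0) :
    ∀ m, B < m → PowerSeries.coeff m (oddRead F) = 0 := fun m hm => by
  rw [oddRead, PowerSeries.coeff_mk]
  exact hF _ (by rw [Finsupp.single_eq_same]; omega)

end Bookkeeping

/-! ## §1 Purely even series: lower class below a mixed reference datum; `α = 0` as carriers -/

/-- **A purely even series is of lower class** relative to any datum `X₀` (depth `ℓ₀ ≥ 1`) of `mix E₀ G₀` with `E₀ ≠ 0` and `G₀ ≠ 0`: the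
even residue is carried by an effective summand of `X₀` with first digit `0`, strictly below the top pair `(e₀, 0)`. [folklore] -/
theorem isLowerClass_psi {ℓ₀ : ℕ} {F₀ : MvPowerSeries (Fin 1) K} {E₀ G₀ : PowerSeries K}
    (X₀ : StandardExpression 2 (xs K 1) 1 ℓ₀ F₀) (hF₀ : F₀ = mix E₀ G₀) (hℓ₀ : 1 ≤ ℓ₀) (hE₀ : E₀ ≠ 0) (hG₀ : G₀ ≠ 0)
    (E' : PowerSeries K) : IsLowerClass X₀ (psi E') := by
  obtain ⟨hα, hβ⟩ := alpha_eq_single_mix X₀ hF₀ hℓ₀ hG₀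
  subst hF₀
  obtain ⟨j, hj⟩ : ∃ j, PowerSeries.coeff j E₀ ≠ 0 := by
    by_contra h
    push Not at h
    exact hE₀ (PowerSeries.ext fun j => by rw [h j, map_zero])
  have hc : MvPowerSeries.coeff (Finsupp.single 0 (2 * j)) (mix E₀ G₀) ≠ 0 := by rwa [coeff_mix_two_mul]
  obtain ⟨s, hs, r, hr⟩ := exists_mem_effSupport_of_coeff_ne_zero hℓ₀ X₀ hc
  obtain ⟨hss, hus⟩ := mem_effSupport.mp hs
  have hb : s.2.1 = 0 := by
    rw [eq_single s.2.1]
    have := X₀.b_lt _ hss 0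
    simp only [Nat.sub_self, pow_zero, Nat.lt_one_iff] at this
    rw [this, Finsupp.single_zero]
  have ha : s.1 = 0 := by
    have ha2 : s.1 0 < 2 := X₀.a_lt _ hss 0
    have h := congr_arg (fun f : Fin 1 →₀ ℕ => f 0) hr
    simp only [Finsupp.single_eq_same, Finsupp.add_apply, Finsupp.smul_apply, smul_eq_mul, hb, Finsupp.coe_zero,
      Pi.zero_apply, mul_zero, add_zero, pow_one] at h
    rw [eq_single s.1]
    have : s.1 0 = 0 := by omega
    rw [this, Finsupp.single_zero]
  intro m hm
  refine ⟨s, hss, hus, ?_, fun i => ?_⟩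
  · -- `(0, 0) <lex (e₀, 0)`
    rw [pairKey, ha, hb, hα, hβ]
    refine Prod.Lex.toLex_lt_toLex.mpr (Or.inl (lt_of_le_of_ne (Finsupp.toLex_monotone fun i => Nat.zero_le _) ?_))
    intro h
    have := congr_arg (fun f : Fin 1 →₀ ℕ => f 0) (toLex_inj.mp h)
    simp at this
  · have hi : i = 0 := Subsingleton.elim _ _
    subst hi
    have h2 : 2 ∣ m 0 := by
      by_contra h2
      rw [coeff_psi, if_neg h2] at hm
      exact hm rfl
    rw [expo, ha, hb]
    simp only [Finsupp.add_apply, Finsupp.smul_apply, smul_eq_mul, Finsupp.coe_zero, Pi.zero_apply, mul_zero, zero_add,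
      pow_one]
    exact (Nat.modEq_zero_iff_dvd.mpr h2).trans (Nat.modEq_zero_iff_dvd.mpr (dvd_mul_right 2 _)).symm

/-- **A purely even carrier has `α = 0`** on every datum of depth `ℓ ≥ 1` (so the proviso `α ≠ 0` of the exit clause fails for it).
[folklore] -/
theorem alpha_eq_zero_of_psi {ℓ : ℕ} {F : MvPowerSeries (Fin 1) K} {E : PowerSeries K}
    (X : StandardExpression 2 (xs K 1) 1 ℓ F) (hF : F = psi E) (hℓ : 1 ≤ ℓ) : alpha X.support X.u = 0 := by
  subst hF
  by_cases hne : (effSupport X.support X.u).Nonempty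
  · obtain ⟨t, ht, h1, -⟩ := exists_top_of_nonempty hne
    obtain ⟨m, hm, hmod⟩ := TopDeriv.exists_coeff_ne_zero_of_mem_effSupport Nat.one_pos hℓ X ht
    have h2 : 2 ∣ m 0 := by
      by_contra h2
      rw [coeff_psi, if_neg h2] at hm
      exact hm rfl
    obtain ⟨hts, -⟩ := mem_effSupport.mp ht
    have hb : t.2.1 0 = 0 := by
      have := X.b_lt _ hts 0
      simp only [Nat.sub_self, pow_zero, Nat.lt_one_iff] at this
      exact this
    have ha2 : t.1 0 < 2 := X.a_lt _ hts 0
    have h0 := hmod 0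
    rw [expo] at h0
    simp only [Finsupp.add_apply, Finsupp.smul_apply, smul_eq_mul, hb, mul_zero, add_zero, pow_one] at h0
    have hpar : m 0 % 2 = (t.1 0 + 2 * t.2.2 0) % 2 := h0
    rw [← h1, eq_single t.1]
    have : t.1 0 = 0 := by omega
    rw [this, Finsupp.single_zero]
  · unfold alpha
    rw [topPair_eq_zero hne]

/-! ## §2 Run level and box-confinement for mixed carriers -/

/-- **Run bridge (bottom digit `≥ 2` at the start), up to the reduced death index.** If the canonical depth-`P` run of `G₀` is non-zero of
order `≥ 2` before `i₁`, every legal depth-`ℓ` run from `mix E₀ G₀` has `εs i = mix E_i (canonRun P G₀ i)` for `i ≤ min N i₁`, for SOME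
passengers `E_i`. [folklore] -/
theorem run_eq_mix_canonRun {ℓ : ℕ} (hℓ : 1 ≤ ℓ) {E₀ G₀ : PowerSeries K} {N : ℕ} {εs : ℕ → MvPowerSeries (Fin 1) K}
    (h0 : εs 0 = mix E₀ G₀) (hrun : IsBottomRun 2 1 ℓ εs N) {i₁ : ℕ}
    (hpre : ∀ i < i₁, ReducedRun.canonRun (2 ^ (ℓ - 1)) G₀ i ≠ 0 ∧
      (2 : ℕ∞) ≤ PowerSeries.order (ReducedRun.canonRun (2 ^ (ℓ - 1)) G₀ i)) :
    ∀ i ≤ N, i ≤ i₁ → ∃ Ei : PowerSeries K, εs i = mix Ei (ReducedRun.canonRun (2 ^ (ℓ - 1)) G₀ i) := by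
  intro i
  induction i with
  | zero => exact fun _ _ => ⟨E₀, h0⟩
  | succ i ih =>
    intro hi hi₁
    obtain ⟨Ei, hεi⟩ := ih (Nat.le_of_succ_le hi) (Nat.le_of_succ_le hi₁)
    obtain ⟨X, w, c, hX0, hsole, -, hw, hstep⟩ := hrun i hi
    obtain ⟨hne, h2⟩ := hpre i hi₁
    have hfin : PowerSeries.order (ReducedRun.canonRun (2 ^ (ℓ - 1)) G₀ i) =
        ((PowerSeries.order (ReducedRun.canonRun (2 ^ (ℓ - 1)) G₀ i)).toNat : ℕ∞) :=
      (ENat.coe_toNat fun h => hne (PowerSeries.order_eq_top.mp h)).symm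
    have h2k : 2 ≤ (PowerSeries.order (ReducedRun.canonRun (2 ^ (ℓ - 1)) G₀ i)).toNat := by
      rw [hfin] at h2
      exact_mod_cast h2
    obtain ⟨E', hE'⟩ := stepAt_eq_mix_canonStepI X hεi hℓ hX0 hfin h2k hsole hw c
    exact ⟨E', by rw [hstep, hE']; rfl⟩

/-- **Lower class persists along a legal run** (res-D-pv-031's one-step persistence, iterated). [folklore] -/
theorem isLowerClass_run_of_isLowerClass {ℓ ℓ₀ : ℕ} (hℓ : 1 ≤ ℓ) {F₀ : MvPowerSeries (Fin 1) K}
    (X₀ : StandardExpression 2 (xs K 1) 1 ℓ₀ F₀) {N : ℕ} {εs : ℕ → MvPowerSeries (Fin 1) K} (hrun : IsBottomRun 2 1 ℓ εs N)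
    {j₀ : ℕ} (hj₀ : IsLowerClass X₀ (εs j₀)) : ∀ j, j₀ ≤ j → j ≤ N → IsLowerClass X₀ (εs j) := by
  intro j hj hjN
  obtain ⟨d, rfl⟩ := Nat.exists_eq_add_of_le hj
  induction d with
  | zero => exact hj₀
  | succ d ih =>
    obtain ⟨X, w, c, hX0, -, -, hw, hstep⟩ := hrun (j₀ + d) (by omega)
    rw [← add_assoc, hstep]
    exact isLowerClass_stepAt_of_isLowerClass X₀ Nat.one_pos (ih (by omega) (by omega)) X hℓ hX0 hw c

/-- **Box-confinement for a mixed carrier from in-box reduced exhaustion of the odd part** (bottom digit `≥ 2` at the start; `E₀ ≠ 0`):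
`StaysInBox 2 1 ℓ X₀` for every reference datum `X₀` of `mix E₀ G₀`. In-box states `i < i₁` have bottom digit `< 2^{ℓ−1}`; the state `i₁`
is the purely even `Ψ E_{i₁}`, of lower class, and lower class persists. [folklore] -/
theorem staysInBox_mix_of_reduced_exhaustion {ℓ₀ ℓ : ℕ} (hℓ : 1 ≤ ℓ) {E₀ G₀ : PowerSeries K} (hE₀ : E₀ ≠ 0) (hG₀ : G₀ ≠ 0)
    {F₀ : MvPowerSeries (Fin 1) K} (X₀ : StandardExpression 2 (xs K 1) 1 ℓ₀ F₀) (hF₀ : F₀ = mix E₀ G₀) (hℓ₀ : 1 ≤ ℓ₀) {i₁ : ℕ}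
    (hpre : ∀ i < i₁, ReducedRun.canonRun (2 ^ (ℓ - 1)) G₀ i ≠ 0 ∧
      (2 : ℕ∞) ≤ PowerSeries.order (ReducedRun.canonRun (2 ^ (ℓ - 1)) G₀ i) ∧
      PowerSeries.order (ReducedRun.canonRun (2 ^ (ℓ - 1)) G₀ i) < ((2 ^ (ℓ - 1) : ℕ) : ℕ∞))
    (hzero : ReducedRun.canonRun (2 ^ (ℓ - 1)) G₀ i₁ = 0) :
    StaysInBox 2 1 ℓ X₀ := by
  intro N εs h0 hrun hnl X hX0
  have h0' : εs 0 = mix E₀ G₀ := by rw [h0, hF₀]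
  rcases Nat.lt_or_ge N i₁ with hlt | hge
  · obtain ⟨EN, hεN⟩ := run_eq_mix_canonRun hℓ h0' hrun (fun i hi => ⟨(hpre i hi).1, (hpre i hi).2.1⟩) N le_rfl hlt.le
    obtain ⟨hne, -, hP⟩ := hpre N hlt
    set GN := ReducedRun.canonRun (2 ^ (ℓ - 1)) G₀ N with hGN
    have hfin : PowerSeries.order GN = ((PowerSeries.order GN).toNat : ℕ∞) :=
      (ENat.coe_toNat fun h => hne (PowerSeries.order_eq_top.mp h)).symm
    rw [hfin] at hP
    exact (depthBox_iff_mix X hεN hℓ hX0 hfin).mpr (by exact_mod_cast hP)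
  · exfalso
    obtain ⟨Ei, hεi⟩ := run_eq_mix_canonRun hℓ h0' hrun (fun i hi => ⟨(hpre i hi).1, (hpre i hi).2.1⟩) i₁ hge le_rfl
    rw [hzero, mix_zero_right] at hεi
    have hlow : IsLowerClass X₀ (εs i₁) := by
      rw [hεi]; exact isLowerClass_psi X₀ hF₀ hℓ₀ hE₀ hG₀ Ei
    exact hnl (isLowerClass_run_of_isLowerClass hℓ X₀ hrun hlow N hge le_rfl)

/-- **Run bridge at bottom digit 1**: after the forced Case-(III) first step the run is `mix E_i (canonRun P G₁ (i−1))`,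
`G₁ = canonStepIIIone P G₀`, up to the reduced death index of `G₁`. [folklore] -/
theorem run_eq_mix_canonRun_digitOne {ℓ : ℕ} (hℓ : 1 ≤ ℓ) {E₀ G₀ : PowerSeries K} (hk : PowerSeries.order G₀ = (1 : ℕ)) {N : ℕ}
    {εs : ℕ → MvPowerSeries (Fin 1) K} (h0 : εs 0 = mix E₀ G₀) (hrun : IsBottomRun 2 1 ℓ εs N) {i₁ : ℕ}
    (hpre : ∀ i < i₁, ReducedRun.canonRun (2 ^ (ℓ - 1)) (ReducedRun.canonStepIIIone (2 ^ (ℓ - 1)) G₀) i ≠ 0 ∧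
      (2 : ℕ∞) ≤ PowerSeries.order (ReducedRun.canonRun (2 ^ (ℓ - 1)) (ReducedRun.canonStepIIIone (2 ^ (ℓ - 1)) G₀) i)) :
    ∀ i, i + 1 ≤ N → i ≤ i₁ → ∃ Ei : PowerSeries K,
      εs (i + 1) = mix Ei (ReducedRun.canonRun (2 ^ (ℓ - 1)) (ReducedRun.canonStepIIIone (2 ^ (ℓ - 1)) G₀) i) := by
  intro i hi hi₁
  obtain ⟨X, w, c, hX0, hsole, -, hw, hstep⟩ := hrun 0 (by omega)
  obtain ⟨E₁, hE₁⟩ := stepAt_eq_mix_canonStepIIIone X h0 hℓ hX0 hk hsole hw c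
  have h1 : εs 1 = mix E₁ (ReducedRun.canonStepIIIone (2 ^ (ℓ - 1)) G₀) := by rw [hstep, hE₁]
  have hrun' : IsBottomRun 2 1 ℓ (fun j => εs (j + 1)) i := fun j hj => hrun (j + 1) (by omega)
  exact run_eq_mix_canonRun hℓ h1 hrun' hpre i le_rfl hi₁

/-- **Box-confinement for a mixed carrier at bottom digit 1** (`ℓ ≥ 2`, `E₀ ≠ 0`, `ord G₀ = 1`) from in-box reduced exhaustion of the
second odd state. [folklore] -/
theorem staysInBox_mix_of_reduced_exhaustion_digitOne {ℓ₀ ℓ : ℕ} (hℓ : 2 ≤ ℓ) {E₀ G₀ : PowerSeries K} (hE₀ : E₀ ≠ 0)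
    (hk : PowerSeries.order G₀ = (1 : ℕ)) {F₀ : MvPowerSeries (Fin 1) K} (X₀ : StandardExpression 2 (xs K 1) 1 ℓ₀ F₀)
    (hF₀ : F₀ = mix E₀ G₀) (hℓ₀ : 1 ≤ ℓ₀) {i₁ : ℕ}
    (hpre : ∀ i < i₁, ReducedRun.canonRun (2 ^ (ℓ - 1)) (ReducedRun.canonStepIIIone (2 ^ (ℓ - 1)) G₀) i ≠ 0 ∧
      (2 : ℕ∞) ≤ PowerSeries.order (ReducedRun.canonRun (2 ^ (ℓ - 1)) (ReducedRun.canonStepIIIone (2 ^ (ℓ - 1)) G₀) i) ∧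
      PowerSeries.order (ReducedRun.canonRun (2 ^ (ℓ - 1)) (ReducedRun.canonStepIIIone (2 ^ (ℓ - 1)) G₀) i) <
        ((2 ^ (ℓ - 1) : ℕ) : ℕ∞))
    (hzero : ReducedRun.canonRun (2 ^ (ℓ - 1)) (ReducedRun.canonStepIIIone (2 ^ (ℓ - 1)) G₀) i₁ = 0) :
    StaysInBox 2 1 ℓ X₀ := by
  have hℓ1 : 1 ≤ ℓ := by omega
  have hG₀ : G₀ ≠ 0 := fun h => by rw [h, PowerSeries.order_zero] at hk; exact ENat.top_ne_coe _ hk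
  intro N εs h0 hrun hnl X hX0
  have h0' : εs 0 = mix E₀ G₀ := by rw [h0, hF₀]
  rcases N with _ | M
  · have h21 : (1 : ℕ) < 2 ^ 1 := by norm_num
    exact (depthBox_iff_mix X h0' hℓ1 hX0 hk).mpr (lt_of_lt_of_le h21 (Nat.pow_le_pow_right two_pos (by omega)))
  · rcases Nat.lt_or_ge M i₁ with hlt | hge
    · obtain ⟨EM, hεM⟩ := run_eq_mix_canonRun_digitOne hℓ1 hk h0' hrun (fun i hi => ⟨(hpre i hi).1, (hpre i hi).2.1⟩)
        M le_rfl hlt.le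
      obtain ⟨hne, -, hP⟩ := hpre M hlt
      set GM := ReducedRun.canonRun (2 ^ (ℓ - 1)) (ReducedRun.canonStepIIIone (2 ^ (ℓ - 1)) G₀) M with hGM
      have hfin : PowerSeries.order GM = ((PowerSeries.order GM).toNat : ℕ∞) :=
        (ENat.coe_toNat fun h => hne (PowerSeries.order_eq_top.mp h)).symm
      rw [hfin] at hP
      exact (depthBox_iff_mix X hεM hℓ1 hX0 hfin).mpr (by exact_mod_cast hP)
    · exfalso
      obtain ⟨Ei, hεi⟩ := run_eq_mix_canonRun_digitOne hℓ1 hk h0' hrun (fun i hi => ⟨(hpre i hi).1, (hpre i hi).2.1⟩)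
        i₁ (by omega) le_rfl
      rw [hzero, mix_zero_right] at hεi
      have hlow : IsLowerClass X₀ (εs (i₁ + 1)) := by
        rw [hεi]; exact isLowerClass_psi X₀ hF₀ hℓ₀ hE₀ hG₀ Ei
      exact hnl (isLowerClass_run_of_isLowerClass hℓ1 X₀ hrun hlow (M + 1) (by omega) le_rfl)

/-! ## §3 `Rescue.CarrierStaysInBox 2 1 (mix E₀ G₀)` for every `E₀` and every finitely supported `G₀` -/

/-- The exit clause is VACUOUS when the odd part has bottom digit `0`: `ord (mix E₀ G₀) ≤ 1 < 2 = p^e`. [folklore] -/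
theorem carrierStaysInBox_mix_of_constantCoeff_ne_zero [ExpChar K 2] [PerfectRing K 2] (E₀ G₀ : PowerSeries K)
    (h0 : PowerSeries.constantCoeff G₀ ≠ 0) : Rescue.CarrierStaysInBox 2 1 (mix E₀ G₀) := by
  intro ℓ₀ X₀ _ _ _ _ hord
  exfalso
  rw [adicOrder_eq_order] at hord
  have hc : MvPowerSeries.coeff (Finsupp.single 0 (2 * 0 + 1)) (mix E₀ G₀) ≠ 0 := by
    rw [coeff_mix_two_mul_add_one, PowerSeries.coeff_zero_eq_constantCoeff_apply]
    exact h0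
  have hle := MvPowerSeries.order_le hc
  rw [Finsupp.degree_single] at hle
  have h21 : ((2 ^ 1 : ℕ) : ℕ∞) < ((2 * 0 + 1 : ℕ) : ℕ∞) := lt_of_lt_of_le hord hle
  exact absurd (by exact_mod_cast h21 : (2 ^ 1 : ℕ) < 2 * 0 + 1) (by norm_num)

/-- The exit clause is VACUOUS for a purely even carrier (`α = 0` on every reference datum). [folklore] -/
theorem carrierStaysInBox_psi [ExpChar K 2] [PerfectRing K 2] (E₀ : PowerSeries K) : Rescue.CarrierStaysInBox 2 1 (psi E₀) := by
  intro ℓ₀ X₀ _ hle _ hα _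
  exact absurd (alpha_eq_zero_of_psi X₀ rfl hle) hα

/-- **`StaysInBox` at every large depth, mixed carrier, bottom digit `≥ 2`** (`E₀ ≠ 0 ≠ G₀`, `G₀` finitely supported): res-L1-type-o6's
`reduced_exhaustion_of_two_le_order` on the odd part. [folklore] -/
theorem staysInBox_mix_eventually_of_two_le_order {E₀ G₀ : PowerSeries K} (hE₀ : E₀ ≠ 0) (hG₀ : G₀ ≠ 0)
    (hfin : ∃ B : ℕ, ∀ m, B < m → PowerSeries.coeff m G₀ = 0) (h2 : (2 : ℕ∞) ≤ PowerSeries.order G₀) :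
    ∃ ℓ₁ : ℕ, 1 ≤ ℓ₁ ∧ ∀ ℓ, ℓ₁ ≤ ℓ → ∀ {ℓ₀ : ℕ} (X₀ : StandardExpression 2 (xs K 1) 1 ℓ₀ (mix E₀ G₀)), 1 ≤ ℓ₀ →
      StaysInBox 2 1 ℓ X₀ := by
  obtain ⟨i₁, Bstar, h⟩ := ReducedRun.reduced_exhaustion_of_two_le_order G₀ hfin h2
  refine ⟨Bstar + 1, by omega, fun ℓ hℓ ℓ₀ X₀ hℓ₀ => ?_⟩
  have hP : Bstar < 2 ^ (ℓ - 1) := lt_of_lt_of_le (Nat.lt_two_pow_self) (Nat.pow_le_pow_right two_pos (by omega))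
  obtain ⟨hpre, hzero⟩ := h (2 ^ (ℓ - 1)) hP
  exact staysInBox_mix_of_reduced_exhaustion (by omega) hE₀ hG₀ X₀ rfl hℓ₀
    (fun i hi => ⟨(hpre i hi).1, (hpre i hi).2.1, by exact_mod_cast (hpre i hi).2.2⟩) hzero

/-- **`StaysInBox` at every large depth, mixed carrier, bottom digit `1`** (`E₀ ≠ 0`, `G₀` finitely supported, `ord G₀ = 1`): the second
odd state `univStepIIIone G₀` is finitely supported of order `≥ 2`, so o6's death theorem applies to it. [folklore] -/
theorem staysInBox_mix_eventually_of_order_eq_one {E₀ G₀ : PowerSeries K} (hE₀ : E₀ ≠ 0)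
    (hfin : ∃ B : ℕ, ∀ m, B < m → PowerSeries.coeff m G₀ = 0) (hk : PowerSeries.order G₀ = (1 : ℕ)) :
    ∃ ℓ₁ : ℕ, 2 ≤ ℓ₁ ∧ ∀ ℓ, ℓ₁ ≤ ℓ → ∀ {ℓ₀ : ℕ} (X₀ : StandardExpression 2 (xs K 1) 1 ℓ₀ (mix E₀ G₀)), 1 ≤ ℓ₀ →
      StaysInBox 2 1 ℓ X₀ := by
  obtain ⟨B, hB⟩ := hfin
  have h00 : PowerSeries.constantCoeff G₀ = 0 := by
    rw [← PowerSeries.coeff_zero_eq_constantCoeff_apply]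
    exact (PowerSeries.order_eq_nat.mp hk).2 0 Nat.one_pos
  set G₁ := ReducedRun.univStepIIIone G₀ with hG₁
  obtain ⟨i₁, Bstar, h⟩ := ReducedRun.reduced_exhaustion_of_two_le_order G₁
    ⟨16 * B, ReducedRun.coeff_univStepIIIone_eq_zero_of_bound hB⟩ (ReducedRun.two_le_order_univStepIIIone h00)
  refine ⟨max Bstar B + 2, by omega, fun ℓ hℓ ℓ₀ X₀ hℓ₀ => ?_⟩
  have hpow : max Bstar B < 2 ^ (ℓ - 1) :=
    lt_of_lt_of_le (Nat.lt_two_pow_self) (Nat.pow_le_pow_right two_pos (by omega))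
  have hP : Bstar < 2 ^ (ℓ - 1) := lt_of_le_of_lt (le_max_left _ _) hpow
  have hcanon : ReducedRun.canonStepIIIone (2 ^ (ℓ - 1)) G₀ = G₁ :=
    ReducedRun.canonStepIIIone_eq_univStepIIIone fun m hm => hB m (by have := le_max_right Bstar B; omega)
  obtain ⟨hpre, hzero⟩ := h (2 ^ (ℓ - 1)) hP
  refine staysInBox_mix_of_reduced_exhaustion_digitOne (by omega) hE₀ hk X₀ rfl hℓ₀ (i₁ := i₁) ?_ ?_
  · intro i hi
    rw [hcanon]
    exact ⟨(hpre i hi).1, (hpre i hi).2.1, by exact_mod_cast (hpre i hi).2.2⟩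
  · rw [hcanon]; exact hzero

/-- **`Rescue.CarrierStaysInBox 2 1 (mix E₀ G₀)` for EVERY even part `E₀` and every FINITELY SUPPORTED odd part `G₀`**, every field `K`
of characteristic `2`. Cases: `E₀ = 0` (twin carrier: res-L1-type-o6 p528277 + `carrierStaysInBox_phi_of_order_eq_one` p529805); `G₀ = 0`
(purely even, vacuous); `G₀(0) ≠ 0` (vacuous); bottom digit `1` / `≥ 2` (the mixed run, `E₀` a passenger). [folklore] -/
theorem carrierStaysInBox_mix [ExpChar K 2] [PerfectRing K 2] (E₀ G₀ : PowerSeries K)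
    (hfin : ∃ B : ℕ, ∀ m, B < m → PowerSeries.coeff m G₀ = 0) : Rescue.CarrierStaysInBox 2 1 (mix E₀ G₀) := by
  by_cases hc0 : PowerSeries.constantCoeff G₀ = 0
  swap
  · exact carrierStaysInBox_mix_of_constantCoeff_ne_zero E₀ G₀ hc0
  by_cases hE₀ : E₀ = 0
  · -- the twin carrier `Φ G₀`
    rw [hE₀, mix_zero_left]
    by_cases hc1 : PowerSeries.coeff 1 G₀ = 0
    · refine carrierStaysInBox_phi_of_two_le_order G₀ hfin (PowerSeries.nat_le_order _ _ fun i hi => ?_)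
      interval_cases i
      · rw [PowerSeries.coeff_zero_eq_constantCoeff]; exact hc0
      · exact hc1
    · refine carrierStaysInBox_phi_of_order_eq_one G₀ hfin (PowerSeries.order_eq_nat.mpr ⟨hc1, fun i hi => ?_⟩)
      interval_cases i
      rw [PowerSeries.coeff_zero_eq_constantCoeff]; exact hc0
  by_cases hG₀ : G₀ = 0
  · rw [hG₀, mix_zero_right]; exact carrierStaysInBox_psi E₀
  by_cases hc1 : PowerSeries.coeff 1 G₀ = 0
  · -- bottom digit `≥ 2`
    have h2 : (2 : ℕ∞) ≤ PowerSeries.order G₀ := PowerSeries.nat_le_order _ _ fun i hi => by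
      interval_cases i
      · rw [PowerSeries.coeff_zero_eq_constantCoeff]; exact hc0
      · exact hc1
    obtain ⟨ℓ₁, -, hℓ₁⟩ := staysInBox_mix_eventually_of_two_le_order hE₀ hG₀ hfin h2
    intro ℓ₀ X₀ _ hle _ _ _
    exact ⟨max ℓ₀ ℓ₁, le_max_left _ _, hℓ₁ _ (le_max_right _ _) X₀ hle⟩
  · -- bottom digit `1`
    have hk : PowerSeries.order G₀ = (1 : ℕ) := PowerSeries.order_eq_nat.mpr ⟨hc1, fun i hi => by
      interval_cases i
      rw [PowerSeries.coeff_zero_eq_constantCoeff]; exact hc0⟩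
    obtain ⟨ℓ₁, -, hℓ₁⟩ := staysInBox_mix_eventually_of_order_eq_one hE₀ hfin hk
    intro ℓ₀ X₀ _ hle _ _ _
    exact ⟨max ℓ₀ ℓ₁, le_max_left _ _, hℓ₁ _ (le_max_right _ _) X₀ hle⟩

/-! ## §4 THE FULL `n = 1, e = 1` SLICE of ⟨`Rescue.FiniteSupportStaysInBox_ours`⟩ at `p = 2` -/

omit [CharP K 2] in
/-- A one-variable polynomial has no coefficients beyond its total degree. [folklore] -/
theorem coeff_coe_eq_zero_of_totalDegree_lt (P : MvPolynomial (Fin 1) K) (d : Fin 1 →₀ ℕ) (hd : P.totalDegree < d 0) :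
    MvPowerSeries.coeff d (P : MvPowerSeries (Fin 1) K) = 0 := by
  rw [MvPolynomial.coeff_coe]
  refine MvPolynomial.coeff_eq_zero_of_totalDegree_lt (lt_of_lt_of_le hd ?_)
  have hd0 : d 0 ≠ 0 := by omega
  exact Finset.single_le_sum (f := fun i => d i) (fun i _ => Nat.zero_le _) (Finsupp.mem_support_iff.mpr hd0)

/-- **THE SLICE THEOREM.** For every field `K` of characteristic `2` (`[ExpChar K 2] [PerfectRing K 2]`, the binders of the OURS premise)
and EVERY one-variable polynomial `P ∈ K[x]`: `Rescue.CarrierStaysInBox 2 1 ↑P` — i.e. the OURS premise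
⟨`Rescue.FiniteSupportStaysInBox_ours 2`⟩ («a POLYNOMIAL carrier keeps the bottom exponent in the Frobenius box at some depth, for every
reference datum») HOLDS ON THE SLICE `n = 1, e = 1`, with NO carrier-shape proviso: `P = E(x²) + x·G(x²)`, the odd part `G` runs as the twin
(res-L1-k24's reduced run; death by res-L1-type-o6's potential; digit 1 by the Case-(III) step), the even part `E` is a lower-pair passenger.
Nothing is claimed for `n ≥ 2`, `e ≥ 2`, odd `p`, or infinite support. OURS objects throughout; nothing about the manuscript. [folklore] -/
theorem carrierStaysInBox_coe_fin_one [ExpChar K 2] [PerfectRing K 2] (P : MvPolynomial (Fin 1) K) :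
    Rescue.CarrierStaysInBox 2 1 (P : MvPowerSeries (Fin 1) K) := by
  have h := carrierStaysInBox_mix (evenRead (P : MvPowerSeries (Fin 1) K)) (oddRead (P : MvPowerSeries (Fin 1) K))
    ⟨P.totalDegree, coeff_oddRead_eq_zero_of_bound fun d hd => coeff_coe_eq_zero_of_totalDegree_lt P d hd⟩
  rwa [mix_evenRead_oddRead] at h

end ReducedBridge

end CampaignW24

end Summit.ResolutionOfSingularities.ResolutionOfSingularities.Theorems

end
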